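import Summits.AnomalousDissipation.AnomalousDissipation.Theorems.SawtoothPulseCascadeSawtoothSigmaMax

/-!
# K2″ `K2LinearisedCascadeGrowth` (stmt-AnomalousDissipation-20025), registered stub S1
`stub_sawtoothSigmaMax` — by name

Route `AnomalousDissipation/SawtoothPulseCascade`, crux K2″, registered BC3 birth line
`Cruxes.K2LinearisedCascadeGrowth.Birth` (skeleton sha `6f95df5d159d`): stub S1 is the certified maximal
normalised Kelvin–Helmholtz rate of the exact triangle-wave shear, `k² · (−c²(k, 0)) ≤ 0.3099²` for all
`k > 0`.  It is, verbatim, the route's support item `SawtoothSigmaMax` (stmt-AnomalousDissipation-19094,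
closed by `Summit.AnomalousDissipation.AnomalousDissipation.Theorems.sawtoothSigmaMax_proof`), i.e. the
Literature certificate `Literature.Analysis.FluidPDE.SawtoothCascade.sq_mul_neg_sawC2zero_le`; this file
only records the stub under its registered name and signature so that the crux's stub ledger credits it.
-/

-- `Summit.<Summit>.<Problem>` is the tree's mandated summit-side namespace (CONVENTIONS §2); for this
-- single-conjunct summit the two coincide, so the duplicate is deliberate (lakefile: off for `Summits`).
set_option linter.dupNamespace false

namespace Summit.AnomalousDissipation.AnomalousDissipation.Theorems.SawtoothPulseCascade.K2Growth

/-- **Registered stub S1 `stub_sawtoothSigmaMax` of K2″** (stmt-AnomalousDissipation-20025): for every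
wavenumber `k > 0`, `k² · (−sawC2zero k) ≤ 0.3099²` — the closed support item `SawtoothSigmaMax`
(`Theorems.sawtoothSigmaMax_proof`, from the Literature certificate `sq_mul_neg_sawC2zero_le`:
`≤ sawSigmaStar² = 0.30982² ≤ 0.3099²`). -/
theorem stub_sawtoothSigmaMax :
    ∀ k : ℝ, 0 < k → k ^ 2 * (-(Literature.Analysis.FluidPDE.SawtoothCascade.sawC2zero k)) ≤ (0.3099 : ℝ) ^ 2 :=
  Summit.AnomalousDissipation.AnomalousDissipation.Theorems.sawtoothSigmaMax_proof

end Summit.AnomalousDissipation.AnomalousDissipation.Theorems.SawtoothPulseCascade.K2Growth
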